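import Literature.Computability.AlgebraicComplexity.BILPS19StabilizerExplicitElementsProofs
import HarnessLib

/-!
# BILPS Thm 21 (stabilizer of `T_{k,n,r}`) — the remaining step of the printed proof and the
# discharge `BILPS2019_thm21_holds`

Proof file (theorem-only, 0 named facts) for `BILPS2019_thm21` of `BILPS19MinrankVarieties.lean`
(Bläser–Ikenmeyer–Lysikov–Pandey–Schreyer, arXiv:1911.02534, Thm 21, proof p0024:L12–44), on top of
`BILPS19StabilizerMonomialProofs.lean` (steps 1/1b: `A = P_σ diag(z)`) and
`BILPS19StabilizerExplicitElementsProofs.lean` (the inclusion `⊇`). Printed steps 2–3, formalised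
with `B' := P̃_σᵀ B`, `C' := P̃_σᵀ C`: the slice equations become `B' (z_a Δ_a) C'ᵀ = Δ_a` for every
block `a` (`slice_eq_of_mem_stab3`); summing over the blocks, "it also preserves its sum … the full
rank diagonal matrix. Therefore, by the Lemma (stabidentity), `C = B̂^{-T}`" (p0024:L29–31):
`B' C'ᵀ = diag(z⁻¹)` (`mul_transpose_eq_diagonal`); then `B'` commutes with every block projection,
so "`B̂` is a block diagonal matrix `diag(Z_1, …, Z_k)`" (p0024:L32–35, `offBlock_eq_zero`), the
blocks are invertible (determinant of a block-diagonal matrix), and `C'ᵀ = B'⁻¹ diag(z⁻¹)` is the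
printed `diag((z_1 Z_1)^{-1}, …)`. Valid over every field (the typed `[IsAlgClosed F]` is unused).
Honest framing (val-lit, row X5-BILPS19): a discharge of a typed literature fact; nothing here bears
on `VP ≠ VNP`, which is NOT proved.
-/

noncomputable section

namespace Literature.Computability.AlgebraicComplexity

open Matrix

section Thm21

open scoped Classical

variable {F : Type*} [Field F] {k' n r : ℕ}

/-- `blockPerm` is a group homomorphism on inverses: `P̃_{σ⁻¹} = P̃_σ⁻¹`.
[cite: BlaserIkenmeyerLysikovPandeySchreyer2019, Thm. 21] -/
theorem blockPerm_inv (σ : Equiv.Perm (Fin k')) :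
    blockPerm (n := n) (r := r) σ⁻¹ = (blockPerm (n := n) (r := r) σ)⁻¹ := by
  ext b
  rcases b with j | ⟨j, i⟩ <;> rfl

/-- The blocks partition `L`: `Σ_a Δ_a = 1`, and more generally `Σ_a c_a Δ_a = diag(c ∘ blk)`.
[cite: BlaserIkenmeyerLysikovPandeySchreyer2019, Thm. 21 (proof)] -/
theorem sum_smul_blockIndicator (c : Option (Fin k') → F) :
    ∑ a, c a • Matrix.diagonal (fun x : BIdx k' n r =>
        if (Sum.elim (fun _ => (none : Option (Fin k'))) (fun q => some q.2) x) = a then (1 : F)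
        else 0) =
      Matrix.diagonal (fun x : BIdx k' n r =>
        c (Sum.elim (fun _ => (none : Option (Fin k'))) (fun q => some q.2) x)) := by
  rw [← sum_smul_bilpsSlice_eq_diagonal]
  refine Finset.sum_congr rfl fun a _ => ?_
  rw [of_bilpsTensor_eq_diagonal]

/-- `Δ_a · diag(d ∘ blk) = d_a · Δ_a`. [cite: BlaserIkenmeyerLysikovPandeySchreyer2019, Thm. 21 (proof)] -/
theorem blockIndicator_mul_diagonal (d : Option (Fin k') → F) (a : Option (Fin k')) :
    Matrix.diagonal (fun x : BIdx k' n r =>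
        if (Sum.elim (fun _ => (none : Option (Fin k'))) (fun q => some q.2) x) = a then (1 : F)
        else 0) *
      Matrix.diagonal (fun x : BIdx k' n r =>
        d (Sum.elim (fun _ => (none : Option (Fin k'))) (fun q => some q.2) x)) =
      d a • Matrix.diagonal (fun x : BIdx k' n r =>
        if (Sum.elim (fun _ => (none : Option (Fin k'))) (fun q => some q.2) x) = a then (1 : F)
        else 0) := by
  rw [Matrix.diagonal_mul_diagonal, Matrix.smul_eq_diagonal_mul, Matrix.diagonal_mul_diagonal]
  congr 1
  funext x
  by_cases h : (Sum.elim (fun _ => (none : Option (Fin k'))) (fun q => some q.2) x) = a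
  · rw [if_pos h, h, one_mul, mul_one]
  · rw [if_neg h, zero_mul, mul_zero]

/-- The diagonal matrix `diag(d ∘ blk)` is block diagonal with scalar blocks.
[cite: BlaserIkenmeyerLysikovPandeySchreyer2019, Thm. 21 (proof)] -/
theorem diagonal_comp_blk_eq_blockDiag3 (d : Option (Fin k') → F) :
    Matrix.diagonal (fun x : BIdx k' n r =>
        d (Sum.elim (fun _ => (none : Option (Fin k'))) (fun q => some q.2) x)) =
      blockDiag3 F (d none • (1 : Matrix (Fin r) (Fin r) F))
        (fun i => d (some i) • (1 : Matrix (Fin n) (Fin n) F)) := by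
  ext x y
  unfold blockDiag3
  rcases x with j | ⟨j, i⟩ <;> rcases y with j' | ⟨j', i'⟩
  · rw [Matrix.fromBlocks_apply₁₁]
    by_cases hj : j = j' <;> simp [hj]
  · rw [Matrix.fromBlocks_apply₁₂]
    simp
  · rw [Matrix.fromBlocks_apply₂₁]
    simp
  · rw [Matrix.fromBlocks_apply₂₂, Matrix.blockDiagonal_apply']
    by_cases hi : i = i'
    · subst hi
      by_cases hj : j = j' <;> simp [hj]
    · simp [hi]

/-- A matrix commuting with every block projection `Δ_a` is block diagonal.
[cite: BlaserIkenmeyerLysikovPandeySchreyer2019, Thm. 21 (proof)] -/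
theorem eq_blockDiag3_of_commute (M : Matrix (BIdx k' n r) (BIdx k' n r) F)
    (hM : ∀ a : Option (Fin k'),
      M * Matrix.diagonal (fun x : BIdx k' n r =>
        if (Sum.elim (fun _ => (none : Option (Fin k'))) (fun q => some q.2) x) = a then (1 : F)
        else 0) =
      Matrix.diagonal (fun x : BIdx k' n r =>
        if (Sum.elim (fun _ => (none : Option (Fin k'))) (fun q => some q.2) x) = a then (1 : F)
        else 0) * M) :
    M = blockDiag3 F (fun j j' => M (Sum.inl j) (Sum.inl j'))
      (fun i => fun j j' => M (Sum.inr (j, i)) (Sum.inr (j', i))) := by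
  have hoff : ∀ x y : BIdx k' n r,
      (Sum.elim (fun _ => (none : Option (Fin k'))) (fun q => some q.2) x) ≠
        (Sum.elim (fun _ => (none : Option (Fin k'))) (fun q => some q.2) y) → M x y = 0 := by
    intro x y hxy
    have h := congr_fun (congr_fun (hM (Sum.elim (fun _ => (none : Option (Fin k')))
      (fun q => some q.2) y)) x) y
    rw [Matrix.mul_diagonal, Matrix.diagonal_mul, if_pos rfl, mul_one, if_neg hxy, zero_mul] at h
    exact h
  ext x y
  unfold blockDiag3
  rcases x with j | ⟨j, i⟩ <;> rcases y with j' | ⟨j', i'⟩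
  · rw [Matrix.fromBlocks_apply₁₁]
  · rw [Matrix.fromBlocks_apply₁₂, Matrix.zero_apply]
    exact hoff _ _ (by simp)
  · rw [Matrix.fromBlocks_apply₂₁, Matrix.zero_apply]
    exact hoff _ _ (by simp)
  · rw [Matrix.fromBlocks_apply₂₂, Matrix.blockDiagonal_apply']
    by_cases hi : i = i'
    · subst hi
      rw [if_pos rfl]
    · rw [if_neg hi]
      exact hoff _ _ (by simpa using hi)

/-- Inverse of a block-diagonal matrix with invertible blocks.
[cite: BlaserIkenmeyerLysikovPandeySchreyer2019, Thm. 21 (proof)] -/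
theorem blockDiag3_inv {A₀ : Matrix (Fin r) (Fin r) F} {A : Fin k' → Matrix (Fin n) (Fin n) F}
    (h₀ : IsUnit A₀.det) (h : ∀ i, IsUnit (A i).det) :
    (blockDiag3 F A₀ A)⁻¹ = blockDiag3 F A₀⁻¹ (fun i => (A i)⁻¹) := by
  apply Matrix.inv_eq_right_inv
  rw [blockDiag3_mul, Matrix.mul_nonsing_inv _ h₀]
  have h1 : (fun i => A i * (A i)⁻¹) = fun _ => (1 : Matrix (Fin n) (Fin n) F) :=
    funext fun i => Matrix.mul_nonsing_inv _ (h i)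
  rw [h1]
  unfold blockDiag3
  rw [show (fun _ : Fin k' => (1 : Matrix (Fin n) (Fin n) F)) = 1 from rfl, Matrix.blockDiagonal_one,
    Matrix.fromBlocks_one]

/-- The combination of slices selected by the row `a` of `A = P_σ' diag(z)` is `z_{σ'a} Δ_{σ'a}`.
[cite: BlaserIkenmeyerLysikovPandeySchreyer2019, Thm. 21 (proof)] -/
theorem sum_permDiag_smul_slice (σ : Equiv.Perm (Fin k')) (z : Option (Fin k') → F)
    (a : Option (Fin k')) :
    ∑ a', (Equiv.Perm.permMatrix F (Equiv.optionCongr σ) * Matrix.diagonal z) a a' •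
        Matrix.of (bilpsTensor F k' n r a') =
      z (Equiv.optionCongr σ a) • Matrix.diagonal (fun x : BIdx k' n r =>
        if (Sum.elim (fun _ => (none : Option (Fin k'))) (fun q => some q.2) x) =
          Equiv.optionCongr σ a then (1 : F) else 0) := by
  rw [Finset.sum_eq_single (Equiv.optionCongr σ a)]
  · rw [PEquiv.toMatrix_mul_apply, Equiv.toPEquiv_apply]
    simp only []
    rw [Matrix.diagonal_apply_eq, of_bilpsTensor_eq_diagonal]
  · intro a' _ ha'
    rw [PEquiv.toMatrix_mul_apply, Equiv.toPEquiv_apply]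
    simp only []
    rw [Matrix.diagonal_apply_ne _ (Ne.symm ha'), zero_smul]
  · exact fun h => absurd (Finset.mem_univ _) h

/-- **BILPS Thm 21, steps 2–3: the normal form of a stabilizer element.** For
`(A, B, C) ∈ Stab T_{k,n,r}` (`1 ≤ r < n`) the triple is one of the explicit elements
`(P_σ diag(z), P̃_σ diag(Z), P̃_σ diag((zZ)^{-T}))`. [cite: BlaserIkenmeyerLysikovPandeySchreyer2019, Thm. 21 (proof)] -/
theorem isBILPSStabElement_of_mem_stab3 (hr : 1 ≤ r) (hrn : r < n)
    {g : GL (Option (Fin k')) F × GL (BIdx k' n r) F × GL (BIdx k' n r) F}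
    (hg : g ∈ stab3 (bilpsTensor F k' n r)) : IsBILPSStabElement F g := by
  obtain ⟨σ, z, hA⟩ := BILPS2019_thm21_step1b hr hrn hg
  -- notation-free abbreviations
  obtain ⟨P, hP⟩ : ∃ P : Matrix (BIdx k' n r) (BIdx k' n r) F,
      P = Equiv.Perm.permMatrix F (blockPerm (n := n) (r := r) σ) := ⟨_, rfl⟩
  obtain ⟨B', hB'⟩ : ∃ B' : Matrix (BIdx k' n r) (BIdx k' n r) F,
      B' = Pᵀ * (g.2.1 : Matrix (BIdx k' n r) (BIdx k' n r) F) := ⟨_, rfl⟩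
  obtain ⟨C', hC'⟩ : ∃ C' : Matrix (BIdx k' n r) (BIdx k' n r) F,
      C' = Pᵀ * (g.2.2 : Matrix (BIdx k' n r) (BIdx k' n r) F) := ⟨_, rfl⟩
  have hPPt : P * Pᵀ = 1 := by
    rw [hP, Matrix.transpose_permMatrix, ← Matrix.permMatrix_mul, inv_mul_cancel,
      Matrix.permMatrix_one]
  have hPtP : Pᵀ * P = 1 := by
    rw [hP, Matrix.transpose_permMatrix, ← Matrix.permMatrix_mul, mul_inv_cancel,
      Matrix.permMatrix_one]
  have hB : (g.2.1 : Matrix (BIdx k' n r) (BIdx k' n r) F) = P * B' := by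
    rw [hB', ← Matrix.mul_assoc, hPPt, Matrix.one_mul]
  have hC : (g.2.2 : Matrix (BIdx k' n r) (BIdx k' n r) F) = P * C' := by
    rw [hC', ← Matrix.mul_assoc, hPPt, Matrix.one_mul]
  -- `Δ` as a function of the block
  obtain ⟨Δ, hΔ⟩ : ∃ Δ : Option (Fin k') → Matrix (BIdx k' n r) (BIdx k' n r) F,
      Δ = fun a => Matrix.diagonal (fun x : BIdx k' n r =>
        if (Sum.elim (fun _ => (none : Option (Fin k'))) (fun q => some q.2) x) = a then (1 : F)
        else 0) := ⟨_, rfl⟩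
  -- conjugation of `Δ_a` by `P̃ᵀ`
  have hconj : ∀ a, Pᵀ * Δ a * P = Δ (Equiv.optionCongr σ a) := by
    intro a
    have hPt : Pᵀ = Equiv.Perm.permMatrix F (blockPerm (n := n) (r := r) σ⁻¹) := by
      rw [hP, Matrix.transpose_permMatrix, blockPerm_inv]
    have hP' : (Equiv.Perm.permMatrix F (blockPerm (n := n) (r := r) σ⁻¹))ᵀ = P := by
      rw [Matrix.transpose_permMatrix, blockPerm_inv, inv_inv, hP]
    rw [hPt, ← hP', hΔ]
    ext b c
    simp only []
    rw [permMatrix_mul_mul_transpose_apply, Matrix.diagonal_apply, Matrix.diagonal_apply,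
      blk_blockPerm]
    simp only [EmbeddingLike.apply_eq_iff_eq]
    have hiff : Equiv.optionCongr σ⁻¹
        (Sum.elim (fun _ => (none : Option (Fin k'))) (fun q => some q.2) b) = a ↔
        Sum.elim (fun _ => (none : Option (Fin k'))) (fun q => some q.2) b = Equiv.optionCongr σ a := by
      rw [Equiv.Perm.inv_def, Equiv.optionCongr_symm]
      exact Equiv.symm_apply_eq _
    simp only [hiff]
  -- the slice equations in the `B', C'` frame: `B' (z_a • Δ_a) C'ᵀ = Δ_a`
  have hslice : ∀ a, B' * ((z a : F) • Δ a) * C'ᵀ = Δ a := by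
    have hstab : actTensor (g.1 : Matrix (Option (Fin k')) (Option (Fin k')) F)
        (g.2.1 : Matrix (BIdx k' n r) (BIdx k' n r) F) (g.2.2 : Matrix (BIdx k' n r) (BIdx k' n r) F)
        (bilpsTensor F k' n r) = bilpsTensor F k' n r := hg
    intro a''
    obtain ⟨a, rfl⟩ := (Equiv.optionCongr σ).surjective a''
    have h : Matrix.of (actTensor (g.1 : Matrix (Option (Fin k')) (Option (Fin k')) F)
        (g.2.1 : Matrix (BIdx k' n r) (BIdx k' n r) F) (g.2.2 : Matrix (BIdx k' n r) (BIdx k' n r) F)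
        (bilpsTensor F k' n r) a) = Matrix.of (bilpsTensor F k' n r a) := by rw [hstab]
    rw [actTensor_slice_eq_mul_sum_mul, hA, sum_permDiag_smul_slice, hB, hC, Matrix.transpose_mul,
      of_bilpsTensor_eq_diagonal] at h
    -- h : P * B' * (z • Δ(σ'a)) * (C'ᵀ * Pᵀ) = Δ a  (with the diagonals spelled out)
    have h' : P * B' * ((z (Equiv.optionCongr σ a) : F) • Δ (Equiv.optionCongr σ a)) *
        (C'ᵀ * Pᵀ) = Δ a := by
      rw [hΔ]
      exact h
    calc B' * ((z (Equiv.optionCongr σ a) : F) • Δ (Equiv.optionCongr σ a)) * C'ᵀ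
        = Pᵀ * (P * B' * ((z (Equiv.optionCongr σ a) : F) • Δ (Equiv.optionCongr σ a)) *
            (C'ᵀ * Pᵀ)) * P := by
          simp only [← Matrix.mul_assoc]
          rw [hPtP, Matrix.one_mul, Matrix.mul_assoc _ Pᵀ P, hPtP, Matrix.mul_one]
      _ = Pᵀ * Δ a * P := by rw [h']
      _ = Δ (Equiv.optionCongr σ a) := hconj a
  -- summing the slice equations: `B' C'ᵀ = diag(z⁻¹ ∘ blk)`
  have hBinv : IsUnit B'.det := by
    rw [hB', Matrix.det_mul, Matrix.det_transpose]
    refine IsUnit.mul ?_ ((Matrix.isUnit_iff_isUnit_det _).1 g.2.1.isUnit)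
    rw [hP]
    exact (Matrix.isUnit_iff_isUnit_det _).1
      (Matrix.isUnit_det_of_right_inverse (hP ▸ hPPt) |> (Matrix.isUnit_iff_isUnit_det _).2)
  have hslice' : ∀ a, B' * Δ a * C'ᵀ = ((z a : F))⁻¹ • Δ a := by
    intro a
    have h := hslice a
    rw [Matrix.mul_smul, Matrix.smul_mul] at h
    conv_rhs => rw [← h]
    rw [smul_smul, inv_mul_cancel₀ (z a).ne_zero, one_smul]
  have hsumΔ : ∑ a, Δ a = 1 := by
    have h := sum_smul_blockIndicator (F := F) (k' := k') (n := n) (r := r) (fun _ => (1 : F))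
    simp only [one_smul] at h
    rw [hΔ, h]
    exact Matrix.diagonal_one
  have hBC : B' * C'ᵀ = Matrix.diagonal (fun x : BIdx k' n r =>
      ((z (Sum.elim (fun _ => (none : Option (Fin k'))) (fun q => some q.2) x) : F))⁻¹) := by
    have h : B' * (∑ a, Δ a) * C'ᵀ = ∑ a, ((z a : F))⁻¹ • Δ a := by
      rw [Matrix.mul_sum, Matrix.sum_mul]
      exact Finset.sum_congr rfl fun a _ => hslice' a
    rw [hsumΔ, Matrix.mul_one, hΔ, sum_smul_blockIndicator] at h
    exact h
  -- `C'ᵀ = B'⁻¹ diag(z⁻¹)` and `B'` commutes with the block projections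
  have hCt : C'ᵀ = B'⁻¹ * Matrix.diagonal (fun x : BIdx k' n r =>
      ((z (Sum.elim (fun _ => (none : Option (Fin k'))) (fun q => some q.2) x) : F))⁻¹) := by
    rw [← hBC, ← Matrix.mul_assoc, Matrix.nonsing_inv_mul _ hBinv, Matrix.one_mul]
  have hcomm : ∀ a, B' * Δ a = Δ a * B' := by
    intro a
    have h := hslice' a
    rw [hCt, ← Matrix.mul_assoc] at h
    -- h : B' Δ B'⁻¹ D = z⁻¹ Δ ; multiply by D⁻¹ = diag(z) on the right and by B' … use Δ D = z⁻¹ Δ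
    have hD : Δ a * Matrix.diagonal (fun x : BIdx k' n r =>
        ((z (Sum.elim (fun _ => (none : Option (Fin k'))) (fun q => some q.2) x) : F))⁻¹) =
        ((z a : F))⁻¹ • Δ a := by
      rw [hΔ]
      exact blockIndicator_mul_diagonal (fun a => ((z a : F))⁻¹) a
    -- from h: (B' Δ B'⁻¹) D = z⁻¹ Δ = Δ D, and D invertible ⇒ B' Δ B'⁻¹ = Δ
    have hDunit : IsUnit (Matrix.diagonal (fun x : BIdx k' n r =>
        ((z (Sum.elim (fun _ => (none : Option (Fin k'))) (fun q => some q.2) x) : F))⁻¹)).det := by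
      rw [Matrix.det_diagonal]
      exact (Finset.prod_ne_zero_iff.2 fun x _ => inv_ne_zero (z _).ne_zero).isUnit
    have h3 : B' * Δ a * B'⁻¹ = Δ a := by
      have h4 : B' * Δ a * B'⁻¹ * Matrix.diagonal (fun x : BIdx k' n r =>
          ((z (Sum.elim (fun _ => (none : Option (Fin k'))) (fun q => some q.2) x) : F))⁻¹) =
          Δ a * Matrix.diagonal (fun x : BIdx k' n r =>
          ((z (Sum.elim (fun _ => (none : Option (Fin k'))) (fun q => some q.2) x) : F))⁻¹) := by
        rw [h, hD]
      have h5 := congrArg (fun M => M * (Matrix.diagonal (fun x : BIdx k' n r =>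
          ((z (Sum.elim (fun _ => (none : Option (Fin k'))) (fun q => some q.2) x) : F))⁻¹))⁻¹) h4
      simp only [Matrix.mul_assoc, Matrix.mul_nonsing_inv _ hDunit, Matrix.mul_one] at h5
      simpa [Matrix.mul_assoc] using h5
    have h6 := congrArg (fun M => M * B') h3
    simp only [Matrix.mul_assoc, Matrix.nonsing_inv_mul _ hBinv, Matrix.mul_one] at h6
    simpa [Matrix.mul_assoc] using h6
  -- `B'` is block diagonal with invertible blocks
  have hB'blk := eq_blockDiag3_of_commute B' (fun a => by
    have h := hcomm a
    rw [hΔ] at h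
    exact h)
  have hdet : B'.det = Matrix.det (fun j j' : Fin r => B' (Sum.inl j) (Sum.inl j')) *
      ∏ i, Matrix.det (fun j j' : Fin n => B' (Sum.inr (j, i)) (Sum.inr (j', i))) := by
    conv_lhs => rw [hB'blk]
    unfold blockDiag3
    rw [Matrix.det_fromBlocks_zero₂₁, Matrix.det_blockDiagonal]
  have hZ₀u : IsUnit (Matrix.det (fun j j' : Fin r => B' (Sum.inl j) (Sum.inl j'))) := by
    have h := hBinv
    rw [hdet] at h
    exact isUnit_of_mul_isUnit_left h
  have hZu : ∀ i, IsUnit (Matrix.det (fun j j' : Fin n => B' (Sum.inr (j, i)) (Sum.inr (j', i)))) := by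
    intro i
    have h := hBinv
    rw [hdet] at h
    have h' := isUnit_of_mul_isUnit_right h
    rw [IsUnit.prod_univ_iff] at h'
    exact h' i
  let Z₀ : GL (Fin r) F := ((Matrix.isUnit_iff_isUnit_det _).2 hZ₀u).unit
  let Z : Fin k' → GL (Fin n) F := fun i => ((Matrix.isUnit_iff_isUnit_det _).2 (hZu i)).unit
  have hZ₀v : (↑Z₀ : Matrix (Fin r) (Fin r) F) = fun j j' => B' (Sum.inl j) (Sum.inl j') :=
    IsUnit.unit_spec _
  have hZv : ∀ i, (↑(Z i) : Matrix (Fin n) (Fin n) F) = fun j j' => B' (Sum.inr (j, i)) (Sum.inr (j', i)) :=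
    fun i => IsUnit.unit_spec _
  have hB'eq : B' = blockDiag3 F (↑Z₀ : Matrix (Fin r) (Fin r) F) (fun i => (↑(Z i) : Matrix (Fin n) (Fin n) F)) := by
    rw [hZ₀v]
    simp only [hZv]
    exact hB'blk
  -- the `C'` block form
  have hsmulinv : ∀ {m : Type} [Fintype m] [DecidableEq m] (c : F) (hc : c ≠ 0) (M : Matrix m m F),
      IsUnit M.det → (c • M)⁻¹ = c⁻¹ • M⁻¹ := by
    intro m _ _ c hc M hM
    apply Matrix.inv_eq_right_inv
    rw [Matrix.smul_mul, Matrix.mul_smul, smul_smul, mul_inv_cancel₀ hc, one_smul,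
      Matrix.mul_nonsing_inv _ hM]
  have hZ₀det : IsUnit (↑Z₀ : Matrix (Fin r) (Fin r) F).det := by rw [hZ₀v]; exact hZ₀u
  have hZdet : ∀ i, IsUnit (↑(Z i) : Matrix (Fin n) (Fin n) F).det := fun i => by rw [hZv]; exact hZu i
  have hC'eq : C' = blockDiag3 F (((z none : F) • (↑Z₀ : Matrix (Fin r) (Fin r) F))⁻¹)ᵀ
      (fun i => (((z (some i) : F) • (↑(Z i) : Matrix (Fin n) (Fin n) F))⁻¹)ᵀ) := by
    rw [← Matrix.transpose_transpose C', hCt, hB'eq, blockDiag3_inv hZ₀det hZdet,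
      diagonal_comp_blk_eq_blockDiag3 (fun o => ((z o : F))⁻¹), blockDiag3_mul, blockDiag3_transpose]
    congr 1
    · rw [hsmulinv _ (z none).ne_zero _ hZ₀det, Matrix.mul_smul, Matrix.mul_one]
    · funext i
      rw [hsmulinv _ (z (some i)).ne_zero _ (hZdet i), Matrix.mul_smul, Matrix.mul_one]
  refine ⟨σ, z, Z₀, Z, hA, ?_, ?_⟩
  · rw [hB, hP, hB'eq]
  · rw [hC, hP, hC'eq]

/-- **BILPS Thm 21 (stabilizer of `T_{k,n,r}`) — DISCHARGED**: `Stab(T_{k,n,r})` is exactly the set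
of explicit elements `(P_σ diag(z), P̃_σ diag(Z), P̃_σ diag((zZ)^{-T}))` (`1 ≤ r < n`; every field).
[cite: BlaserIkenmeyerLysikovPandeySchreyer2019, Thm. 21] -/
theorem BILPS2019_thm21_holds : BILPS2019_thm21 := by
  intro F _ _ k' n r hr hrn
  ext g
  exact ⟨fun hg => isBILPSStabElement_of_mem_stab3 hr hrn hg,
    fun hg => stab3_of_isBILPSStabElement g hg⟩

end Thm21

end Literature.Computability.AlgebraicComplexity
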